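import Mathlib

/-!
# A weighted energy identity on a half-line for recessive first-order systems

Let `S, T : ℝ → ℝ` be linked on `[a, ∞)` by the first-order relation
`S′ = α·T + d·S + f` and write `u := (S − T)/2`, `v := (S + T)/2` (so `S = u + v`, `T = v − u`).
For a weight `g ≥ 0` with `g·S² → 0` at `+∞`, one integration by parts gives the EXACT identity

  `∫_{(a,∞)} g α (v² − u²) = ∫ g α S T = −g(a) S(a)²/2 − ∫ (g′/2 + g d) S² − ∫ g f S`,

i.e. `∫ gα v² + g(a)S(a)²/2 + ∫ (g′/2 + g d) S² = ∫ gα u² − ∫ g f S`: whenever the *margin*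
`g′/2 + g d` is positive, the map `u ↦ v` is a contraction in `L²(gα)` on EVERY half-line, up to the
forcing `f`, with two nonnegative gain terms (the outflow `g(a)S(a)²/2` through the left end and the
bulk term `∫ (g′/2 + g d) S²`).  With `g = e^{2στ}/α` this is the weighted-`L²` stability estimate for
the recessive (decaying at `+∞`) solution `v` of `v′ − α v = −u′ − α u + …` used, rung by rung, for
Riccati–Crum chains (`v = −u + 2·(α-average of u ahead)`); the flat constant-coefficient case is the
Fourier-multiplier fact `|(α − iξ − σ)/(α + iξ + σ)| ≤ 1`.
We record the identity (`integral_weight_mul_eq`), its `u,v` form (`weighted_sq_identity`) and the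
resulting one-sided estimate with the forcing absorbed by half of the margin
(`weighted_sq_le`). [folklore]
-/

noncomputable section

namespace Literature.Analysis.ODE

open Set MeasureTheory Filter Topology

/-- **Half-line energy identity.**  If `S′ = α T + d S + f` on `[a, ∞)`, `g` is differentiable there
with derivative `g′`, `g S² → 0` at `+∞`, and the four products below are integrable on `(a, ∞)`,
then `∫ g α S T = −g(a) S(a)²/2 − ∫ (g′/2 + g d) S² − ∫ g f S`. [folklore] -/
theorem integral_weight_mul_eq {S T f α d g g' : ℝ → ℝ} {a : ℝ}
    (hS : ∀ τ, a ≤ τ → HasDerivAt S (α τ * T τ + d τ * S τ + f τ) τ)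
    (hg : ∀ τ, a ≤ τ → HasDerivAt g (g' τ) τ)
    (hlim : Tendsto (fun τ => g τ * S τ ^ 2) atTop (𝓝 0))
    (hi₁ : IntegrableOn (fun τ => g τ * α τ * (S τ * T τ)) (Ioi a))
    (hi₂ : IntegrableOn (fun τ => g' τ * S τ ^ 2) (Ioi a))
    (hi₃ : IntegrableOn (fun τ => g τ * d τ * S τ ^ 2) (Ioi a))
    (hi₄ : IntegrableOn (fun τ => g τ * f τ * S τ) (Ioi a)) :
    ∫ τ in Ioi a, g τ * α τ * (S τ * T τ) =
      -(g a * S a ^ 2 / 2) - (∫ τ in Ioi a, (g' τ / 2 + g τ * d τ) * S τ ^ 2)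
        - ∫ τ in Ioi a, g τ * f τ * S τ := by
  -- φ := g S² / 2 has derivative g' S²/2 + g S S' = g' S²/2 + g α S T + g d S² + g f S
  have hφ : ∀ τ ∈ Ici a, HasDerivAt (fun τ => g τ * S τ ^ 2 / 2)
      (g' τ * S τ ^ 2 / 2 + g τ * α τ * (S τ * T τ) + g τ * d τ * S τ ^ 2 + g τ * f τ * S τ) τ := by
    intro τ hτ
    have h1 := hg τ hτ
    have h2 := hS τ hτ
    have h3 : HasDerivAt (fun τ => S τ ^ 2) (2 * S τ * (α τ * T τ + d τ * S τ + f τ)) τ := by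
      simpa using h2.fun_pow 2
    have h4 := (h1.mul h3).div_const 2
    refine h4.congr_deriv ?_
    ring
  have hint : IntegrableOn (fun τ => g' τ * S τ ^ 2 / 2 + g τ * α τ * (S τ * T τ)
      + g τ * d τ * S τ ^ 2 + g τ * f τ * S τ) (Ioi a) :=
    (((hi₂.div_const 2).add hi₁).add hi₃).add hi₄
  have hlim' : Tendsto (fun τ => g τ * S τ ^ 2 / 2) atTop (𝓝 0) := by
    simpa using hlim.div_const 2
  have hFTC := integral_Ioi_of_hasDerivAt_of_tendsto' hφ hint hlim'
  -- split the integral of the derivative into its four summands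
  have hsplit : (∫ τ in Ioi a, g' τ * S τ ^ 2 / 2 + g τ * α τ * (S τ * T τ)
      + g τ * d τ * S τ ^ 2 + g τ * f τ * S τ) =
      (∫ τ in Ioi a, g' τ * S τ ^ 2 / 2) + (∫ τ in Ioi a, g τ * α τ * (S τ * T τ))
        + (∫ τ in Ioi a, g τ * d τ * S τ ^ 2) + ∫ τ in Ioi a, g τ * f τ * S τ := by
    have e1 : (∫ τ in Ioi a, g' τ * S τ ^ 2 / 2 + g τ * α τ * (S τ * T τ)
        + g τ * d τ * S τ ^ 2 + g τ * f τ * S τ) =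
        (∫ τ in Ioi a, g' τ * S τ ^ 2 / 2 + g τ * α τ * (S τ * T τ) + g τ * d τ * S τ ^ 2)
          + ∫ τ in Ioi a, g τ * f τ * S τ :=
      integral_add (((hi₂.div_const 2).add hi₁).add hi₃) hi₄
    have e2 : (∫ τ in Ioi a, g' τ * S τ ^ 2 / 2 + g τ * α τ * (S τ * T τ) + g τ * d τ * S τ ^ 2) =
        (∫ τ in Ioi a, g' τ * S τ ^ 2 / 2 + g τ * α τ * (S τ * T τ))
          + ∫ τ in Ioi a, g τ * d τ * S τ ^ 2 :=
      integral_add ((hi₂.div_const 2).add hi₁) hi₃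
    have e3 : (∫ τ in Ioi a, g' τ * S τ ^ 2 / 2 + g τ * α τ * (S τ * T τ)) =
        (∫ τ in Ioi a, g' τ * S τ ^ 2 / 2) + ∫ τ in Ioi a, g τ * α τ * (S τ * T τ) :=
      integral_add (hi₂.div_const 2) hi₁
    rw [e1, e2, e3]
  have hhalf : (∫ τ in Ioi a, (g' τ / 2 + g τ * d τ) * S τ ^ 2) =
      (∫ τ in Ioi a, g' τ * S τ ^ 2 / 2) + ∫ τ in Ioi a, g τ * d τ * S τ ^ 2 := by
    rw [← integral_add (hi₂.div_const 2) hi₃]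
    refine integral_congr_ae (ae_of_all _ fun τ => ?_)
    ring
  rw [hsplit] at hFTC
  rw [hhalf]
  simp only [zero_sub] at hFTC
  linarith

/-- **The `u, v` form.**  With `S = u + v`, `T = v − u` the identity `integral_weight_mul_eq` reads
`∫ gα v² + g(a) S(a)²/2 + ∫ (g′/2 + g d) S² = ∫ gα u² − ∫ g f S`
(exact; all three terms moved to the left are nonnegative when `g ≥ 0`, `α ≥ 0` and the margin
`g′/2 + g d ≥ 0`). [folklore] -/
theorem weighted_sq_identity {u v S T f α d g g' : ℝ → ℝ} {a : ℝ}
    (hSuv : ∀ τ, S τ = u τ + v τ) (hTuv : ∀ τ, T τ = v τ - u τ)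
    (hS : ∀ τ, a ≤ τ → HasDerivAt S (α τ * T τ + d τ * S τ + f τ) τ)
    (hg : ∀ τ, a ≤ τ → HasDerivAt g (g' τ) τ)
    (hlim : Tendsto (fun τ => g τ * S τ ^ 2) atTop (𝓝 0))
    (hu : IntegrableOn (fun τ => g τ * α τ * u τ ^ 2) (Ioi a))
    (hv : IntegrableOn (fun τ => g τ * α τ * v τ ^ 2) (Ioi a))
    (hi₂ : IntegrableOn (fun τ => g' τ * S τ ^ 2) (Ioi a))
    (hi₃ : IntegrableOn (fun τ => g τ * d τ * S τ ^ 2) (Ioi a))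
    (hi₄ : IntegrableOn (fun τ => g τ * f τ * S τ) (Ioi a)) :
    (∫ τ in Ioi a, g τ * α τ * v τ ^ 2) + g a * S a ^ 2 / 2
        + (∫ τ in Ioi a, (g' τ / 2 + g τ * d τ) * S τ ^ 2) =
      (∫ τ in Ioi a, g τ * α τ * u τ ^ 2) - ∫ τ in Ioi a, g τ * f τ * S τ := by
  have hST : ∀ τ, g τ * α τ * (S τ * T τ) = g τ * α τ * v τ ^ 2 - g τ * α τ * u τ ^ 2 := by
    intro τ; rw [hSuv, hTuv]; ring
  have hi₁ : IntegrableOn (fun τ => g τ * α τ * (S τ * T τ)) (Ioi a) := by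
    have := hv.sub hu
    refine this.congr_fun (fun τ _ => ?_) measurableSet_Ioi
    simp only [Pi.sub_apply, hST]
  have key := integral_weight_mul_eq hS hg hlim hi₁ hi₂ hi₃ hi₄
  have hdiff : (∫ τ in Ioi a, g τ * α τ * (S τ * T τ)) =
      (∫ τ in Ioi a, g τ * α τ * v τ ^ 2) - ∫ τ in Ioi a, g τ * α τ * u τ ^ 2 := by
    rw [← integral_sub hv hu]
    exact integral_congr_ae (ae_of_all _ fun τ => hST τ)
  rw [hdiff] at key
  linarith

/-- **One-sided weighted estimate.**  In the situation of `weighted_sq_identity`, if `g ≥ 0` and the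
margin dominates a positive function, `2 κ ≤ g′/2 + g d` with `κ > 0` on `(a, ∞)`, then the forcing
is absorbed by half of the margin:
`∫ gα v² + g(a) S(a)²/2 + ∫ κ S² ≤ ∫ gα u² + ∫ g² f²/(4κ)`. [folklore] -/
theorem weighted_sq_le {u v S T f α d g g' κ : ℝ → ℝ} {a : ℝ}
    (hSuv : ∀ τ, S τ = u τ + v τ) (hTuv : ∀ τ, T τ = v τ - u τ)
    (hS : ∀ τ, a ≤ τ → HasDerivAt S (α τ * T τ + d τ * S τ + f τ) τ)
    (hg : ∀ τ, a ≤ τ → HasDerivAt g (g' τ) τ)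
    (hlim : Tendsto (fun τ => g τ * S τ ^ 2) atTop (𝓝 0))
    (hu : IntegrableOn (fun τ => g τ * α τ * u τ ^ 2) (Ioi a))
    (hv : IntegrableOn (fun τ => g τ * α τ * v τ ^ 2) (Ioi a))
    (hi₂ : IntegrableOn (fun τ => g' τ * S τ ^ 2) (Ioi a))
    (hi₃ : IntegrableOn (fun τ => g τ * d τ * S τ ^ 2) (Ioi a))
    (hi₄ : IntegrableOn (fun τ => g τ * f τ * S τ) (Ioi a))
    (hκ : IntegrableOn (fun τ => κ τ * S τ ^ 2) (Ioi a))
    (hF : IntegrableOn (fun τ => g τ ^ 2 * f τ ^ 2 / (4 * κ τ)) (Ioi a))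
    (hκpos : ∀ τ, a < τ → 0 < κ τ)
    (hmargin : ∀ τ, a < τ → 2 * κ τ ≤ g' τ / 2 + g τ * d τ) :
    (∫ τ in Ioi a, g τ * α τ * v τ ^ 2) + g a * S a ^ 2 / 2 + (∫ τ in Ioi a, κ τ * S τ ^ 2) ≤
      (∫ τ in Ioi a, g τ * α τ * u τ ^ 2) + ∫ τ in Ioi a, g τ ^ 2 * f τ ^ 2 / (4 * κ τ) := by
  have key := weighted_sq_identity hSuv hTuv hS hg hlim hu hv hi₂ hi₃ hi₄
  -- (i) the margin integral dominates `∫ 2κ S²`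
  have hm : (∫ τ in Ioi a, 2 * κ τ * S τ ^ 2) ≤ ∫ τ in Ioi a, (g' τ / 2 + g τ * d τ) * S τ ^ 2 := by
    have hl : IntegrableOn (fun τ => 2 * κ τ * S τ ^ 2) (Ioi a) := by
      have h0 : IntegrableOn (fun τ => 2 * (κ τ * S τ ^ 2)) (Ioi a) := hκ.const_mul 2
      exact h0.congr_fun (fun τ _ => by ring) measurableSet_Ioi
    have hr : IntegrableOn (fun τ => (g' τ / 2 + g τ * d τ) * S τ ^ 2) (Ioi a) := by
      have h0 : IntegrableOn (fun τ => g' τ * S τ ^ 2 / 2 + g τ * d τ * S τ ^ 2) (Ioi a) :=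
        (hi₂.div_const 2).add hi₃
      exact h0.congr_fun (fun τ _ => by ring) measurableSet_Ioi
    refine setIntegral_mono_on hl hr measurableSet_Ioi (fun τ hτ => ?_)
    exact mul_le_mul_of_nonneg_right (hmargin τ hτ) (sq_nonneg _)
  -- (ii) pointwise Young: −g f S ≤ κ S² + g² f²/(4κ)
  have hy : (∫ τ in Ioi a, -(g τ * f τ * S τ)) ≤
      ∫ τ in Ioi a, (κ τ * S τ ^ 2 + g τ ^ 2 * f τ ^ 2 / (4 * κ τ)) := by
    refine setIntegral_mono_on hi₄.neg (hκ.add hF) measurableSet_Ioi (fun τ hτ => ?_)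
    have hk := hκpos τ hτ
    have h4 : (0 : ℝ) < 4 * κ τ := by positivity
    -- κ S² + g²f²/(4κ) + g f S = (2κ S + g f)²/(4κ) ≥ 0
    have : κ τ * S τ ^ 2 + g τ ^ 2 * f τ ^ 2 / (4 * κ τ) + g τ * f τ * S τ =
        (2 * κ τ * S τ + g τ * f τ) ^ 2 / (4 * κ τ) := by
      field_simp
      ring
    have hnn : 0 ≤ (2 * κ τ * S τ + g τ * f τ) ^ 2 / (4 * κ τ) := by positivity
    linarith
  have h2 : (∫ τ in Ioi a, 2 * κ τ * S τ ^ 2) = 2 * ∫ τ in Ioi a, κ τ * S τ ^ 2 := by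
    rw [← integral_const_mul]
    exact integral_congr_ae (ae_of_all _ fun τ => by ring)
  have h3 : (∫ τ in Ioi a, (κ τ * S τ ^ 2 + g τ ^ 2 * f τ ^ 2 / (4 * κ τ))) =
      (∫ τ in Ioi a, κ τ * S τ ^ 2) + ∫ τ in Ioi a, g τ ^ 2 * f τ ^ 2 / (4 * κ τ) :=
    integral_add hκ hF
  have h4 : (∫ τ in Ioi a, -(g τ * f τ * S τ)) = -∫ τ in Ioi a, g τ * f τ * S τ :=
    integral_neg _
  rw [h2] at hm
  rw [h3, h4] at hy
  linarith

/-- **Weighted resolvent bound for the recessive solution.**  If `T′ = A T + F` on `[a, ∞)`,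
`g T² → 0` at `+∞` and `w := g A + g′/2 > 0` on `(a, ∞)`, then
`∫ w T² + g(a) T(a)² ≤ ∫ g² F²/w`: the decaying solution is controlled by the forcing with the gain
`1/w` (for `g = e^{2στ}`, `A ≥ A₀`: `‖T‖ ≤ ‖F‖/(A₀ + σ)` in `L²(e^{2στ}dτ)`). [folklore] -/
theorem weighted_resolvent_le {T F A g g' w : ℝ → ℝ} {a : ℝ}
    (hT : ∀ τ, a ≤ τ → HasDerivAt T (A τ * T τ + F τ) τ)
    (hg : ∀ τ, a ≤ τ → HasDerivAt g (g' τ) τ)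
    (hw : ∀ τ, w τ = g τ * A τ + g' τ / 2)
    (hlim : Tendsto (fun τ => g τ * T τ ^ 2) atTop (𝓝 0))
    (hi₁ : IntegrableOn (fun τ => w τ * T τ ^ 2) (Ioi a))
    (hi₂ : IntegrableOn (fun τ => g τ * T τ * F τ) (Ioi a))
    (hi₃ : IntegrableOn (fun τ => g τ ^ 2 * F τ ^ 2 / w τ) (Ioi a))
    (hwpos : ∀ τ, a < τ → 0 < w τ) :
    (∫ τ in Ioi a, w τ * T τ ^ 2) + g a * T a ^ 2 ≤ ∫ τ in Ioi a, g τ ^ 2 * F τ ^ 2 / w τ := by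
  have hφ : ∀ τ ∈ Ici a, HasDerivAt (fun τ => g τ * T τ ^ 2 / 2)
      (w τ * T τ ^ 2 + g τ * T τ * F τ) τ := by
    intro τ hτ
    have h1 := hg τ hτ
    have h2 := hT τ hτ
    have h3 : HasDerivAt (fun τ => T τ ^ 2) (2 * T τ * (A τ * T τ + F τ)) τ := by
      simpa using h2.fun_pow 2
    have h4 := (h1.mul h3).div_const 2
    refine h4.congr_deriv ?_
    rw [hw]
    ring
  have hlim' : Tendsto (fun τ => g τ * T τ ^ 2 / 2) atTop (𝓝 0) := by
    simpa using hlim.div_const 2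
  have hFTC := integral_Ioi_of_hasDerivAt_of_tendsto' hφ (hi₁.add hi₂) hlim'
  have e1 : (∫ τ in Ioi a, w τ * T τ ^ 2 + g τ * T τ * F τ) =
      (∫ τ in Ioi a, w τ * T τ ^ 2) + ∫ τ in Ioi a, g τ * T τ * F τ := integral_add hi₁ hi₂
  -- Young: −g T F ≤ w T²/2 + g² F²/(2w)
  have hy : (∫ τ in Ioi a, -(g τ * T τ * F τ)) ≤
      ∫ τ in Ioi a, (w τ * T τ ^ 2 / 2 + g τ ^ 2 * F τ ^ 2 / w τ / 2) := by
    refine setIntegral_mono_on hi₂.neg ((hi₁.div_const 2).add (hi₃.div_const 2))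
      measurableSet_Ioi (fun τ hτ => ?_)
    have hk := hwpos τ hτ
    have : w τ * T τ ^ 2 / 2 + g τ ^ 2 * F τ ^ 2 / w τ / 2 + g τ * T τ * F τ =
        (w τ * T τ + g τ * F τ) ^ 2 / (2 * w τ) := by
      field_simp
      ring
    have hnn : 0 ≤ (w τ * T τ + g τ * F τ) ^ 2 / (2 * w τ) := by positivity
    linarith
  have e2 : (∫ τ in Ioi a, (w τ * T τ ^ 2 / 2 + g τ ^ 2 * F τ ^ 2 / w τ / 2)) =
      (∫ τ in Ioi a, w τ * T τ ^ 2 / 2) + ∫ τ in Ioi a, g τ ^ 2 * F τ ^ 2 / w τ / 2 :=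
    integral_add (hi₁.div_const 2) (hi₃.div_const 2)
  have e3 : (∫ τ in Ioi a, w τ * T τ ^ 2 / 2) = (∫ τ in Ioi a, w τ * T τ ^ 2) / 2 := by
    rw [← integral_div]
  have e4 : (∫ τ in Ioi a, g τ ^ 2 * F τ ^ 2 / w τ / 2) = (∫ τ in Ioi a, g τ ^ 2 * F τ ^ 2 / w τ) / 2 := by
    rw [← integral_div]
  have e5 : (∫ τ in Ioi a, -(g τ * T τ * F τ)) = -∫ τ in Ioi a, g τ * T τ * F τ := integral_neg _
  rw [e1] at hFTC
  rw [e2, e3, e4, e5] at hy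
  simp only [zero_sub] at hFTC
  linarith

end Literature.Analysis.ODE
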